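import Summits.QuantumFields.BalabanUV.T4Continuum.Spine.NE3.FrameNormalisationOneLevel
import Literature.MathematicalPhysics.QuantumFieldTheory.Balaban1983to89.BlockAveragingFederbush
import HarnessLib

/-!
# T⁴ programme, node NE3 — census R50 open half (M1), SIXTH BRICK: the `δ`-twisted exponent is LIPSCHITZ in the twist — two gauges whose covariant block oscillations are
# `ε`-close have twisted exponents `(1 + ρ∕(1−ρ))·(1+t)·ε`-close (`FrameNormalisationDefectLipschitz`)

Cell `pub-balaban-gaps` (track G2, seat ne3, generation 11), row NE3; census `HOME/ne/NE3.md` §4 R50, §17 (M1).  `FrameNormalisationDefectSize.norm_twistedSum_sub_Fcov_le` compares the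
`δ`-twisted exponent `F_δ(y) = Σ_r L^{−d} log[T_r·δ_r⁻¹]` (`T_r = (R_{0,y}V₁)(Γ_{y,y+r})`) with the untwisted one (`δ ≡ 1`).  The CONTRACTION of (M1) needs the same estimate between
TWO twists — the Lipschitz dependence of the twisted exponent (hence, through the generic `FrameNormalisationDefectSize.norm_framed_sub_framed_le`, of the twisted frames and of the
`δ`-framed double-bar average) on the covariant block oscillations of the gauge, i.e. on its corner data:

* **`norm_twistedSum_sub_twistedSum_le`** — abstract twists `a_r, b_r` (units) with `‖T_r − 1‖ ≤ t`, `‖a_r − 1‖, ‖b_r − 1‖ ≤ η`, `t + (1+t)η ≤ ρ < 1` and `‖a_r − b_r‖ ≤ ε`: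
  **`‖Σ_r L^{−d} log[T_r a_r] − Σ_r L^{−d} log[T_r b_r]‖ ≤ (1 + ρ∕(1−ρ))·(1+t)·ε`** (`FederbushMean.norm_mlog_sub_mlog_le` on the `‖· − 1‖ ≤ ρ` ball, averaged over the block);
* `norm_twistedSum_sub_twistedSum_le_gauge` — the instance `a_r = δ_{v}(y,Γ_r)⁻¹`, `b_r = δ_{v′}(y,Γ_r)⁻¹` for two gauges `v, v′` at the same background: the twisted exponents of
  `FrameNormalisationDefect` ∕ `FrameNormalisationTowerExists` are `(1 + ρ∕(1−ρ))(1+t)`-Lipschitz in `sup_r ‖δ_v(y,Γ_r)⁻¹ − δ_{v′}(y,Γ_r)⁻¹‖`.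

HONEST FRAMING (page 1).  Elementary Banach-algebra estimates on OUR objects (0 def, 0 sorry); the contraction itself (iteration through the `k` levels for the smooth corner
interpolant (154e), jointly with (1.38)) is NOT done; nothing of Bałaban's asserted; **NE3 NOT proved**; `PairLandauGaugeB8Avg` and the covariant root NOT proved; spine PROVED 0∕9;
finite T⁴ rung (B)+1 — NOT continuum YM on ℝ⁴, NOT infinite volume, NOT mass gap, NOT `BetaPertH`, NOT Clay.  HONEST DEPENDENCY: continuum YM on T⁴ ⇐ BetaPertH ∧ nine spine estimates
(0/9 proved); BetaPertH ⇐ (D1) ∧ (D4) ∧ CAP+tail; G-an2-4 gates asym, D1 and NE2/3/4.  PLACEMENT: `Summits/QuantumFields/BalabanUV/T4Continuum/Spine/NE3/`; imports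
`FrameNormalisationOneLevel` and `BlockAveragingFederbush` only.

References: [Balaban1985Averaging] T. Bałaban, *Averaging operations for lattice gauge theories*, CMP 98 (1985) 17–51: (21) p. 21, (58) p. 27, (62) p. 28, (82) p. 30.
-/

set_option autoImplicit false

open scoped BigOperators Matrix Matrix.Norms.L2Operator
open NormedSpace

namespace Summit.QuantumFields.BalabanUV.T4Continuum.NE3.FrameNormalisationDefectLipschitz

open Literature.MathematicalPhysics.QuantumFieldTheory.Balaban1983to89
open B7Prop1Explicit B7Prop2Explicit MatrixLog
open B7Eq92Concrete (Rc Rc_apply tHol)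
open FederbushMean (norm_mlog_sub_mlog_le)

noncomputable section

variable {d : ℕ} {n : Type*} [Fintype n] [DecidableEq n]

/-- **THE TWISTED EXPONENT IS LIPSCHITZ IN THE TWIST** (abstract twists `a_r`, `b_r`): with `‖T_r − 1‖ ≤ t`, `‖a_r − 1‖, ‖b_r − 1‖ ≤ η`, `t + (1+t)η ≤ ρ < 1`, `‖a_r − b_r‖ ≤ ε`:
`‖Σ_r L^{−d} log[T_r a_r] − Σ_r L^{−d} log[T_r b_r]‖ ≤ (1 + ρ∕(1−ρ))·(1+t)·ε`. [folklore] -/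
theorem norm_twistedSum_sub_twistedSum_le [Nonempty n] (L : ℕ) (T a b : (Fin d → Fin L) → (Matrix n n ℂ)ˣ)
    {t η ρ ε : ℝ} (ht : 0 ≤ t) (hη : 0 ≤ η) (hε : 0 ≤ ε) (hρ : t + (1 + t) * η ≤ ρ) (hρ1 : ρ < 1)
    (hT : ∀ r, ‖((T r : (Matrix n n ℂ)ˣ) : Matrix n n ℂ) - 1‖ ≤ t)
    (ha : ∀ r, ‖((a r : (Matrix n n ℂ)ˣ) : Matrix n n ℂ) - 1‖ ≤ η) (hb : ∀ r, ‖((b r : (Matrix n n ℂ)ˣ) : Matrix n n ℂ) - 1‖ ≤ η)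
    (hab : ∀ r, ‖((a r : (Matrix n n ℂ)ˣ) : Matrix n n ℂ) - ((b r : (Matrix n n ℂ)ˣ) : Matrix n n ℂ)‖ ≤ ε) :
    ‖(∑ r : Fin d → Fin L, (((L : ℝ) ^ d)⁻¹) • mlog (((T r * a r : (Matrix n n ℂ)ˣ)) : Matrix n n ℂ))
      - ∑ r : Fin d → Fin L, (((L : ℝ) ^ d)⁻¹) • mlog (((T r * b r : (Matrix n n ℂ)ˣ)) : Matrix n n ℂ)‖
      ≤ (1 + ρ / (1 - ρ)) * ((1 + t) * ε) := by
  set K : ℝ := (1 + ρ / (1 - ρ)) * ((1 + t) * ε) with hK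
  have hρ0 : 0 ≤ ρ := le_trans (by positivity) hρ
  have hlip : 0 ≤ 1 + ρ / (1 - ρ) := by
    have : 0 ≤ ρ / (1 - ρ) := div_nonneg hρ0 (by linarith)
    linarith
  have hK0 : 0 ≤ K := by positivity
  -- each twisted holonomy lies in the `ρ`-ball: `‖T c − 1‖ ≤ ‖T‖‖c − 1‖ + ‖T − 1‖ ≤ (1+t)η + t ≤ ρ`
  have hball : ∀ (r : Fin d → Fin L) (c : (Matrix n n ℂ)ˣ), ‖((c : (Matrix n n ℂ)ˣ) : Matrix n n ℂ) - 1‖ ≤ η →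
      ‖((T r : (Matrix n n ℂ)ˣ) : Matrix n n ℂ) * (c : Matrix n n ℂ) - 1‖ ≤ ρ := by
    intro r c hc
    have hTn : ‖((T r : (Matrix n n ℂ)ˣ) : Matrix n n ℂ)‖ ≤ 1 + t := by
      have h := norm_le_norm_add_norm_sub' ((T r : (Matrix n n ℂ)ˣ) : Matrix n n ℂ) 1
      rw [norm_one] at h
      linarith [hT r]
    have h1 : ((T r : (Matrix n n ℂ)ˣ) : Matrix n n ℂ) * (c : Matrix n n ℂ) - 1
        = ((T r : (Matrix n n ℂ)ˣ) : Matrix n n ℂ) * ((c : Matrix n n ℂ) - 1) + (((T r : (Matrix n n ℂ)ˣ) : Matrix n n ℂ) - 1) := by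
      rw [mul_sub, mul_one]; abel
    rw [h1]
    calc _ ≤ ‖((T r : (Matrix n n ℂ)ˣ) : Matrix n n ℂ) * ((c : Matrix n n ℂ) - 1)‖ + ‖((T r : (Matrix n n ℂ)ˣ) : Matrix n n ℂ) - 1‖ := norm_add_le _ _
      _ ≤ (1 + t) * η + t := by
          refine add_le_add ((norm_mul_le _ _).trans (mul_le_mul hTn hc (norm_nonneg _) (by linarith))) (hT r)
      _ ≤ ρ := by linarith
  have hterm : ∀ r : Fin d → Fin L,
      ‖mlog (((T r * a r : (Matrix n n ℂ)ˣ)) : Matrix n n ℂ) - mlog (((T r * b r : (Matrix n n ℂ)ˣ)) : Matrix n n ℂ)‖ ≤ K := by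
    intro r
    rw [Units.val_mul, Units.val_mul]
    have hTn : ‖((T r : (Matrix n n ℂ)ˣ) : Matrix n n ℂ)‖ ≤ 1 + t := by
      have h := norm_le_norm_add_norm_sub' ((T r : (Matrix n n ℂ)ˣ) : Matrix n n ℂ) 1
      rw [norm_one] at h
      linarith [hT r]
    have hdiff : ‖((T r : (Matrix n n ℂ)ˣ) : Matrix n n ℂ) * (a r : Matrix n n ℂ) - ((T r : (Matrix n n ℂ)ˣ) : Matrix n n ℂ) * (b r : Matrix n n ℂ)‖
        ≤ (1 + t) * ε := by
      rw [← mul_sub]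
      exact (norm_mul_le _ _).trans (mul_le_mul hTn (hab r) (norm_nonneg _) (by linarith))
    calc _ ≤ (1 + ρ / (1 - ρ)) * ‖((T r : (Matrix n n ℂ)ˣ) : Matrix n n ℂ) * (a r : Matrix n n ℂ)
              - ((T r : (Matrix n n ℂ)ˣ) : Matrix n n ℂ) * (b r : Matrix n n ℂ)‖ :=
          norm_mlog_sub_mlog_le hρ1 (hball r (a r) (ha r)) (hball r (b r) (hb r))
      _ ≤ K := mul_le_mul_of_nonneg_left hdiff hlip
  rw [← Finset.sum_sub_distrib]
  have hc0 : 0 ≤ ((L : ℝ) ^ d)⁻¹ := by positivity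
  calc ‖∑ r : Fin d → Fin L, ((((L : ℝ) ^ d)⁻¹) • mlog (((T r * a r : (Matrix n n ℂ)ˣ)) : Matrix n n ℂ)
          - (((L : ℝ) ^ d)⁻¹) • mlog (((T r * b r : (Matrix n n ℂ)ˣ)) : Matrix n n ℂ))‖
      ≤ ∑ r : Fin d → Fin L, ((L : ℝ) ^ d)⁻¹ * K := by
        refine (norm_sum_le _ _).trans (Finset.sum_le_sum fun r _ => ?_)
        rw [← smul_sub, norm_smul, Real.norm_of_nonneg hc0]
        exact mul_le_mul_of_nonneg_left (hterm r) hc0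
    _ = ((Fintype.card (Fin d → Fin L) : ℝ) * ((L : ℝ) ^ d)⁻¹) * K := by
        rw [Finset.sum_const, nsmul_eq_mul, Finset.card_univ, mul_assoc]
    _ ≤ 1 * K := by
        refine mul_le_mul_of_nonneg_right ?_ hK0
        rw [Fintype.card_fun, Fintype.card_fin, Fintype.card_fin, Nat.cast_pow]
        exact mul_inv_le_one
    _ = K := one_mul K

/-- **TWO GAUGES**: the `δ`-twisted exponents (of `FrameNormalisationDefect` ∕ `FrameNormalisationTowerExists`) of two gauges `v, v′` at the same background and perturbation differ by at
most `(1 + ρ∕(1−ρ))(1+t)·ε`, `ε = sup_r ‖δ_v(y,Γ_r)⁻¹ − δ_{v′}(y,Γ_r)⁻¹‖` — the Lipschitz dependence on the corner data that the contraction of (M1) iterates. [folklore] -/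
theorem norm_twistedSum_sub_twistedSum_le_gauge [Nonempty n] (L : ℕ) (V₀ V₁ : Site d → Fin d → (Matrix n n ℂ)ˣ) (v v' : Site d → (Matrix n n ℂ)ˣ) (y : Site d)
    {t η ρ ε : ℝ} (ht : 0 ≤ t) (hη : 0 ≤ η) (hε : 0 ≤ ε) (hρ : t + (1 + t) * η ≤ ρ) (hρ1 : ρ < 1)
    (hT : ∀ r : Fin d → Fin L, ‖((tHol V₀ V₁ y (treeWord (boxVec L r)) : (Matrix n n ℂ)ˣ) : Matrix n n ℂ) - 1‖ ≤ t)
    (ha : ∀ r : Fin d → Fin L,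
      ‖(((((v y)⁻¹ * Rc (hol V₀ y (treeWord (boxVec L r))) (v (y + boxVec L r)))⁻¹ : (Matrix n n ℂ)ˣ)) : Matrix n n ℂ) - 1‖ ≤ η)
    (hb : ∀ r : Fin d → Fin L,
      ‖(((((v' y)⁻¹ * Rc (hol V₀ y (treeWord (boxVec L r))) (v' (y + boxVec L r)))⁻¹ : (Matrix n n ℂ)ˣ)) : Matrix n n ℂ) - 1‖ ≤ η)
    (hab : ∀ r : Fin d → Fin L,
      ‖(((((v y)⁻¹ * Rc (hol V₀ y (treeWord (boxVec L r))) (v (y + boxVec L r)))⁻¹ : (Matrix n n ℂ)ˣ)) : Matrix n n ℂ)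
        - (((((v' y)⁻¹ * Rc (hol V₀ y (treeWord (boxVec L r))) (v' (y + boxVec L r)))⁻¹ : (Matrix n n ℂ)ˣ)) : Matrix n n ℂ)‖ ≤ ε) :
    ‖(∑ r : Fin d → Fin L, (((L : ℝ) ^ d)⁻¹) •
        mlog ((tHol V₀ V₁ y (treeWord (boxVec L r)) *
          ((v y)⁻¹ * Rc (hol V₀ y (treeWord (boxVec L r))) (v (y + boxVec L r)))⁻¹ : (Matrix n n ℂ)ˣ) : Matrix n n ℂ))
      - ∑ r : Fin d → Fin L, (((L : ℝ) ^ d)⁻¹) •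
        mlog ((tHol V₀ V₁ y (treeWord (boxVec L r)) *
          ((v' y)⁻¹ * Rc (hol V₀ y (treeWord (boxVec L r))) (v' (y + boxVec L r)))⁻¹ : (Matrix n n ℂ)ˣ) : Matrix n n ℂ)‖
      ≤ (1 + ρ / (1 - ρ)) * ((1 + t) * ε) :=
  norm_twistedSum_sub_twistedSum_le L (fun r => tHol V₀ V₁ y (treeWord (boxVec L r)))
    (fun r => ((v y)⁻¹ * Rc (hol V₀ y (treeWord (boxVec L r))) (v (y + boxVec L r)))⁻¹)
    (fun r => ((v' y)⁻¹ * Rc (hol V₀ y (treeWord (boxVec L r))) (v' (y + boxVec L r)))⁻¹) ht hη hε hρ hρ1 hT ha hb hab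

end

end Summit.QuantumFields.BalabanUV.T4Continuum.NE3.FrameNormalisationDefectLipschitz
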